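import Summits.AtomisticToContinuum.Crystallization.Theorems.OverbindingBudgetEnergyLayerTailSum

/-!
# OverbindingBudget · decomp-a2c lens-4 g34 — part XXII-W: the FAR-LAYER FORCE is `O(P⁻⁵)` (analytic tail leaf of the GEO-OSC node)

Helper file under `--supports stmt-AtomisticToContinuum-31280` (RDEF = `Theses.OverbindingBudget.RobustDefectLimitWindows`); closes nothing.

The force analogue of part XXII-K/L's layer-FIELD tail (`layerField_far : |layerField a b v| ≤ 5 P⁻⁴`): for independent periods
`a, b` of an admissible cell (`‖a‖, ‖b‖ ≤ 17/16`, Gram determinant `≥ 9/20`) with unit normal `n` and an offset `v` at height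
`|⟪v, n⟫| = |P| ≥ 15/8` (ANY lateral part), the pair-force family `pairForce (v + (i a + j b))` is summable and

  ★ `norm_layerForce_far : ‖layerForce a b v‖ ≤ 19 · |P|⁻⁵`.

Proof: `‖pairForce x‖ = |r⁻¹³ − r⁻⁷| ≤ r⁻⁷ ≤ |P|⁻¹ r⁻⁶` for `r = ‖x‖ ≥ |P| ≥ 1`, and `Σ r⁻⁶ = Σ ((P² + ‖·‖²)⁻¹)³ ≤ 8π/(2√G T₂²) ≤ (2520/134) P⁻⁴`
exactly as in part K (`tsum_inv_cube_le_smear` with smear `ε = 1`, `R_c = 17/16`, `T₂ ≥ P²`, `√G ≥ 67/100`, `π < 3.15`).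
Use (memo §I, g35 GEO-OSC node): the far stress across a gap (part V `farStress`) is a sum over layer pairs of span `s ≥ 2`, height
`≥ s·h_lo`; this lemma bounds the pairs beyond the certified spans by `Σ_{s ≥ s₁} s · 19/(s h_lo)⁵ = (19/h_lo⁵) Σ_{s ≥ s₁} s⁻⁴`.
-/

namespace Summit.AtomisticToContinuum.Crystallization.Theorems.OverbindingBudgetEnergyForceTail

open Real
open scoped RealInnerProductSpace
open Summit.AtomisticToContinuum.Crystallization.Theorems.ChartedPlanarOrderChunkFloor (E3)
open Summit.AtomisticToContinuum.Crystallization.Theorems.ChartedPlanarOrderProfileSlavingLJ (pairForce layerForce)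
open Summit.AtomisticToContinuum.Crystallization.Theorems.OverbindingBudgetRegistryCut (IsUnitNormal)
open Summit.AtomisticToContinuum.Crystallization.Theorems.OverbindingBudgetEnergyLayerTail
  (exists_planar_coords norm_sq_add_planar tsum_inv_cube_le_smear)
open Summit.AtomisticToContinuum.Crystallization.Theorems.OverbindingBudgetEnergyLayerTailSum (cellRadius_le gram_ge_of_cell)

/-! ## §1 The pair force beyond unit distance -/

/-- `‖pairForce x‖ ≤ ‖x‖⁻⁷` for `‖x‖ ≥ 1` (there `r⁻¹³ ≤ r⁻⁷`, so `|r⁻¹⁴ − r⁻⁸|·r = r⁻⁷ − r⁻¹³`). -/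
theorem norm_pairForce_le {x : E3} (hx : 1 ≤ ‖x‖) : ‖pairForce x‖ ≤ (‖x‖⁻¹) ^ 7 := by
  have hr : 0 < ‖x‖ := by linarith
  have hi0 : 0 ≤ ‖x‖⁻¹ := inv_nonneg.mpr hr.le
  have hi1 : ‖x‖⁻¹ ≤ 1 := inv_le_one_of_one_le₀ hx
  have h148 : (‖x‖⁻¹) ^ 14 ≤ (‖x‖⁻¹) ^ 8 := pow_le_pow_of_le_one hi0 hi1 (by norm_num)
  unfold pairForce
  rw [norm_smul, Real.norm_eq_abs, abs_of_nonpos (by linarith), neg_sub]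
  have e : (‖x‖⁻¹) ^ 7 = (‖x‖⁻¹) ^ 8 * ‖x‖ := by
    have h8 : (‖x‖⁻¹) ^ 8 = (‖x‖⁻¹) ^ 7 * ‖x‖⁻¹ := pow_succ _ 7
    rw [h8, mul_assoc, inv_mul_cancel₀ hr.ne', mul_one]
  rw [e]
  have h14 : 0 ≤ (‖x‖⁻¹) ^ 14 := by positivity
  nlinarith

/-- `‖pairForce x‖ ≤ Q⁻¹ · (‖x‖²)⁻³` for `‖x‖ ≥ Q ≥ 1`. -/
theorem norm_pairForce_le_of_le {x : E3} {Q : ℝ} (hQ : 1 ≤ Q) (hx : Q ≤ ‖x‖) :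
    ‖pairForce x‖ ≤ Q⁻¹ * ((‖x‖ ^ 2)⁻¹) ^ 3 := by
  have hr : 0 < ‖x‖ := by linarith
  have h7 := norm_pairForce_le (hQ.trans hx)
  have hiQ : ‖x‖⁻¹ ≤ Q⁻¹ := by
    rw [inv_le_inv₀ hr (by linarith)]; exact hx
  have e : (‖x‖⁻¹) ^ 7 = ‖x‖⁻¹ * ((‖x‖ ^ 2)⁻¹) ^ 3 := by
    rw [← inv_pow]; ring
  rw [e] at h7
  have h6 : 0 ≤ ((‖x‖ ^ 2)⁻¹) ^ 3 := by positivity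
  calc ‖pairForce x‖ ≤ ‖x‖⁻¹ * ((‖x‖ ^ 2)⁻¹) ^ 3 := h7
    _ ≤ Q⁻¹ * ((‖x‖ ^ 2)⁻¹) ^ 3 := by gcongr

/-! ## §2 ★ The far-layer force bound -/

/-- the general smeared bound: summable pair-force family and `‖layerForce a b v‖ ≤ |P|⁻¹ (1+ε)³ π/(2√G T₂²)` at height `|P| ≥ 1`,
`T₂ = (1+ε)P² − (1+1/ε)R_c² > 0`. -/
theorem norm_layerForce_bounds {a b n v : E3} (hab : LinearIndependent ℝ ![a, b]) (hn : IsUnitNormal a b n) {Rc ε : ℝ} (hε : 0 < ε)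
    (hRc : ∀ ζ₁ ζ₂ : ℝ, |ζ₁| ≤ 1 / 2 → |ζ₂| ≤ 1 / 2 → ‖ζ₁ • a + ζ₂ • b‖ ≤ Rc)
    (hT : 0 < (1 + ε) * ⟪v, n⟫ ^ 2 - (1 + ε⁻¹) * Rc ^ 2) (hP : 1 ≤ |⟪v, n⟫|) :
    Summable (fun ij : ℤ × ℤ => pairForce (v + (((ij.1 : ℤ) : ℝ) • a + ((ij.2 : ℤ) : ℝ) • b))) ∧
      ‖layerForce a b v‖ ≤ |⟪v, n⟫|⁻¹ * ((1 + ε) ^ 3 * (π / (2 * Real.sqrt (‖a‖ ^ 2 * ‖b‖ ^ 2 - ⟪a, b⟫ ^ 2) *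
          ((1 + ε) * ⟪v, n⟫ ^ 2 - (1 + ε⁻¹) * Rc ^ 2) ^ 2))) := by
  have hn' := hn
  obtain ⟨hn1, hna, hnb⟩ := hn'
  set P := ⟪v, n⟫ with hPdef
  have hu : ⟪v - P • n, n⟫ = 0 := by
    rw [inner_sub_left, real_inner_smul_left, real_inner_self_eq_norm_sq, hn1]; ring
  obtain ⟨c₁, c₂, hc⟩ := exists_planar_coords hab hn hu
  have hdist : ∀ ij : ℤ × ℤ, ‖v + (((ij.1 : ℤ) : ℝ) • a + ((ij.2 : ℤ) : ℝ) • b)‖ ^ 2 =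
      P ^ 2 + ‖((ij.1 : ℝ) + c₁) • a + ((ij.2 : ℝ) + c₂) • b‖ ^ 2 := by
    intro ij
    have hv : v = P • n + (c₁ • a + c₂ • b) := by rw [← hc]; abel
    have hv' : v + (((ij.1 : ℤ) : ℝ) • a + ((ij.2 : ℤ) : ℝ) • b) = P • n + ((((ij.1 : ℝ) + c₁) • a + ((ij.2 : ℝ) + c₂) • b)) := by
      rw [hv, add_smul, add_smul]; abel
    have hw : ⟪n, ((ij.1 : ℝ) + c₁) • a + ((ij.2 : ℝ) + c₂) • b⟫ = 0 := by
      rw [inner_add_right, real_inner_smul_right, real_inner_smul_right, hna, hnb]; ring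
    rw [hv', norm_sq_add_planar hn1 hw]
  obtain ⟨hFs, hFle⟩ := tsum_inv_cube_le_smear hab (t := P) hε hRc hT c₁ c₂
  have hQ1 : 1 ≤ |P| := hP
  have hQpos : 0 < |P| := by linarith
  -- every lattice image is at distance `≥ |P|`
  have hrQ : ∀ ij : ℤ × ℤ, |P| ≤ ‖v + (((ij.1 : ℤ) : ℝ) • a + ((ij.2 : ℤ) : ℝ) • b)‖ := by
    intro ij
    have h2 : |P| ^ 2 ≤ ‖v + (((ij.1 : ℤ) : ℝ) • a + ((ij.2 : ℤ) : ℝ) • b)‖ ^ 2 := by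
      rw [hdist ij, sq_abs]; nlinarith [sq_nonneg ‖((ij.1 : ℝ) + c₁) • a + ((ij.2 : ℝ) + c₂) • b‖]
    exact abs_le_of_sq_le_sq' (by rw [sq_abs] at h2 ⊢; nlinarith [h2, sq_abs P]) (norm_nonneg _) |>.2
  -- termwise majorant
  have hmaj : ∀ ij : ℤ × ℤ, ‖pairForce (v + (((ij.1 : ℤ) : ℝ) • a + ((ij.2 : ℤ) : ℝ) • b))‖ ≤
      |P|⁻¹ * ((P ^ 2 + ‖((ij.1 : ℝ) + c₁) • a + ((ij.2 : ℝ) + c₂) • b‖ ^ 2)⁻¹) ^ 3 := by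
    intro ij
    have h := norm_pairForce_le_of_le hQ1 (hrQ ij)
    rwa [hdist ij] at h
  have hGs : Summable fun ij : ℤ × ℤ => |P|⁻¹ * ((P ^ 2 + ‖((ij.1 : ℝ) + c₁) • a + ((ij.2 : ℝ) + c₂) • b‖ ^ 2)⁻¹) ^ 3 :=
    hFs.mul_left _
  have hSum : Summable (fun ij : ℤ × ℤ => pairForce (v + (((ij.1 : ℤ) : ℝ) • a + ((ij.2 : ℤ) : ℝ) • b))) :=
    Summable.of_norm_bounded hGs hmaj
  refine ⟨hSum, ?_⟩
  have h1 : ‖layerForce a b v‖ ≤ ∑' ij : ℤ × ℤ, ‖pairForce (v + (((ij.1 : ℤ) : ℝ) • a + ((ij.2 : ℤ) : ℝ) • b))‖ := by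
    unfold layerForce
    exact norm_tsum_le_tsum_norm hSum.norm
  have h2 := Summable.tsum_le_tsum hmaj hSum.norm hGs
  rw [tsum_mul_left] at h2
  have h3 : |P|⁻¹ * ∑' ij : ℤ × ℤ, ((P ^ 2 + ‖((ij.1 : ℝ) + c₁) • a + ((ij.2 : ℝ) + c₂) • b‖ ^ 2)⁻¹) ^ 3 ≤
      |P|⁻¹ * ((1 + ε) ^ 3 * (π / (2 * Real.sqrt (‖a‖ ^ 2 * ‖b‖ ^ 2 - ⟪a, b⟫ ^ 2) *
          ((1 + ε) * P ^ 2 - (1 + ε⁻¹) * Rc ^ 2) ^ 2))) :=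
    mul_le_mul_of_nonneg_left hFle (inv_nonneg.mpr hQpos.le)
  linarith

/-- ★★ THE FAR-LAYER FORCE IS `O(P⁻⁵)`: over an admissible cell (`‖a‖, ‖b‖ ≤ 17/16`, Gram `≥ 9/20`), at height `|⟪v, n⟫| = |P| ≥ 15/8`
and for ANY lateral part, the pair-force family is summable and `‖layerForce a b v‖ ≤ 19 |P|⁻⁵`. -/
theorem norm_layerForce_far {a b n v : E3} (hab : LinearIndependent ℝ ![a, b]) (hn : IsUnitNormal a b n) (ha : ‖a‖ ≤ 17 / 16)
    (hb : ‖b‖ ≤ 17 / 16) (hG : 9 / 20 ≤ ‖a‖ ^ 2 * ‖b‖ ^ 2 - ⟪a, b⟫ ^ 2) {P : ℝ} (hP : ⟪v, n⟫ = P) (hP0 : 15 / 8 ≤ |P|) :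
    Summable (fun ij : ℤ × ℤ => pairForce (v + (((ij.1 : ℤ) : ℝ) • a + ((ij.2 : ℤ) : ℝ) • b))) ∧
      ‖layerForce a b v‖ ≤ 19 * (|P| ^ 5)⁻¹ := by
  have hP2 : 225 / 64 ≤ P ^ 2 := by rw [← sq_abs]; nlinarith
  have hT : 0 < (1 + 1) * ⟪v, n⟫ ^ 2 - (1 + 1⁻¹) * (17 / 16 : ℝ) ^ 2 := by rw [hP]; norm_num; nlinarith
  have hP1 : 1 ≤ |⟪v, n⟫| := by rw [hP]; linarith
  obtain ⟨hS, hle⟩ := norm_layerForce_bounds hab hn one_pos (cellRadius_le ha hb) hT hP1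
  rw [hP] at hle
  refine ⟨hS, ?_⟩
  set T2 := (1 + 1) * P ^ 2 - (1 + 1⁻¹) * (17 / 16 : ℝ) ^ 2 with hT2
  have hT2ge : P ^ 2 ≤ T2 := by rw [hT2]; norm_num; nlinarith
  have hP4 : P ^ 4 ≤ T2 ^ 2 := by
    rw [show P ^ 4 = (P ^ 2) ^ 2 by ring]; exact pow_le_pow_left₀ (by positivity) hT2ge 2
  have h67 : (67 / 100 : ℝ) ≤ Real.sqrt (‖a‖ ^ 2 * ‖b‖ ^ 2 - ⟪a, b⟫ ^ 2) := by
    rw [Real.le_sqrt' (by norm_num)]; nlinarith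
  have hπ : π ≤ 3.15 := Real.pi_lt_d2.le
  have hQpos : 0 < |P| := by linarith
  have hPpos : 0 < P ^ 4 := by
    have : P ≠ 0 := abs_pos.mp hQpos
    positivity
  have hX : π / (2 * Real.sqrt (‖a‖ ^ 2 * ‖b‖ ^ 2 - ⟪a, b⟫ ^ 2) * T2 ^ 2) ≤ 3.15 / (2 * (67 / 100) * P ^ 4) := by
    calc π / (2 * Real.sqrt (‖a‖ ^ 2 * ‖b‖ ^ 2 - ⟪a, b⟫ ^ 2) * T2 ^ 2)
        ≤ 3.15 / (2 * Real.sqrt (‖a‖ ^ 2 * ‖b‖ ^ 2 - ⟪a, b⟫ ^ 2) * T2 ^ 2) := by gcongr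
      _ ≤ 3.15 / (2 * (67 / 100) * P ^ 4) := by gcongr
  have e4 : P ^ 4 = |P| ^ 4 := (Even.pow_abs ⟨2, by norm_num⟩ P).symm
  have hfin : |P|⁻¹ * ((1 + 1) ^ 3 * (π / (2 * Real.sqrt (‖a‖ ^ 2 * ‖b‖ ^ 2 - ⟪a, b⟫ ^ 2) * T2 ^ 2))) ≤ 19 * (|P| ^ 5)⁻¹ := by
    have hY : (1 + 1 : ℝ) ^ 3 * (π / (2 * Real.sqrt (‖a‖ ^ 2 * ‖b‖ ^ 2 - ⟪a, b⟫ ^ 2) * T2 ^ 2)) ≤ 19 * (|P| ^ 4)⁻¹ := by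
      have e : (3.15 : ℝ) / (2 * (67 / 100) * P ^ 4) = 315 / 134 * (P ^ 4)⁻¹ := by field_simp; ring
      rw [e, e4] at hX
      have hq : 0 < (|P| ^ 4)⁻¹ := by positivity
      nlinarith
    calc |P|⁻¹ * ((1 + 1 : ℝ) ^ 3 * (π / (2 * Real.sqrt (‖a‖ ^ 2 * ‖b‖ ^ 2 - ⟪a, b⟫ ^ 2) * T2 ^ 2)))
        ≤ |P|⁻¹ * (19 * (|P| ^ 4)⁻¹) := mul_le_mul_of_nonneg_left hY (inv_nonneg.mpr hQpos.le)
      _ = 19 * (|P| ^ 5)⁻¹ := by field_simp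
  exact hle.trans hfin

/-- the same with the cell hypotheses in the admissible-cell form (lattice vectors `≥ 9/10` give Gram `≥ 9/20`, part L `gram_ge_of_cell`). -/
theorem norm_layerForce_far_of_cell {a b n v : E3} (hab : LinearIndependent ℝ ![a, b]) (hn : IsUnitNormal a b n) (ha : ‖a‖ ≤ 17 / 16)
    (hb : ‖b‖ ≤ 17 / 16) (hlat : ∀ i j : ℤ, ((i : ℝ) • a + (j : ℝ) • b) ≠ 0 → 9 / 10 ≤ ‖(i : ℝ) • a + (j : ℝ) • b‖)
    {P : ℝ} (hP : ⟪v, n⟫ = P) (hP0 : 15 / 8 ≤ |P|) :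
    ‖layerForce a b v‖ ≤ 19 * (|P| ^ 5)⁻¹ :=
  (norm_layerForce_far hab hn ha hb (gram_ge_of_cell hab ha hb hlat) hP hP0).2

end Summit.AtomisticToContinuum.Crystallization.Theorems.OverbindingBudgetEnergyForceTail
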